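import Literature.NumberTheory.EllipticCurves.ModularSymbolsProofs
import Literature.NumberTheory.EllipticCurves.MazurTateElementCoeffField
import Summits.BirchSwinnertonDyer.BirchSwinnertonDyer.Theorems.ResidualThetaTransportAtTwoThetaLayerLambdaCongruenceAtTwoDepletionExact
import HarnessLib

/-!
# Crux `ThetaLayerLambdaCongruenceAtTwo` (stmt-BirchSwinnertonDyer-20688, route ResidualThetaTransportAtTwo), line
# `birth`: MANIN RELATIONS for plus symbols, their dilations and their depleted combinations — the carrier
# «Γ₀(N)-modular-symbol function» for the plus-line stub (C3) of the (H-sym) plan (lead prover bsd-wall-rtt-p3 g2;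
# `--supports stmt-BirchSwinnertonDyer-20688 --as helper`; closes nothing)

HONEST FRAMING. THEOREMS of the tree's definitions only; nothing about any curve or form is asserted; BSD is not proved
by any of this.

WHAT. A function `Φ : ℚ → R` (`R` an additive group) is a (weight-2) Γ₀(N)-MODULAR-SYMBOL FUNCTION if it satisfies
Manin's relation `Φ(γ·r) = Φ(γ·∞) + Φ(r)` for all `γ ∈ Γ₀(N)` and `r ∈ ℚ` with `γ·r ≠ ∞` (cusp term `Φ(a/c)`, read as
`0` when `c = 0`) — written INLINE throughout in the exact shape of the tree's `modularSymbol_gamma0_smul` (no new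
definition). Such `Φ` are the `Γ₀(N)`-invariant additive maps on degree-`0` divisors of `P¹(ℚ)` read on `{∞ → r}`, i.e.
`Hom(H₁(X₀(N), cusps; ℤ), R)` (Manin 1972 Thm. 1.9). THIS FILE:
* §1 `plusSymbol_gamma0_smul`: the PLUS symbol `plusSymbol g = ({∞,r} + {∞,−r})/2` of any weight-`2` cusp form on
  `Γ₀(N)` is a Γ₀(N)-symbol function (from the tree theorem `modularSymbol_gamma0_smul_holds` at `γ` and at
  `γ' = εγε = (a, −b; −c, d)`, `γ'·(−r) = −γ·r`, `γ'·∞ = −γ·∞`); hence so are `ι ∘ [·]⁺_{g,Ω}` at a plus period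
  (`embPlusSymbolK_gamma0_smul`) and `[·]⁺_f = ratPlusSymbol f` of a rational newform (`ratPlusSymbol_gamma0_smul`).
* §2 STRUCTURE: Γ₀(N)-symbol functions are stable under scalars, finite sums, passing to a multiple of the level, and
  under DILATION `r ↦ Φ(r·m)` at the cost of level `N·m` (`γ = (a,b;c,d) ∈ Γ₀(Nm)` ↦ `γ_m = (a, bm; c/m, d) ∈ Γ₀(N)`
  with `(γ·r)·m = γ_m·(r·m)`) — the operator `[m]` of the depletion `∏_v P_v(ℓ_v⁻¹[ℓ_v])`.
* §3 hence every DEPLETED plus symbol `∑_k c_k · Φ(r·m_k)` (the explicit shape of `…DepletionExact`, `m_k ∣ m`) is a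
  Γ₀(N·m)-symbol function (`gamma0_smul_sum_dilate`).
These are the «Manin» hypotheses of the plus-line stub (C3) `stub_plusLineAtTwo` of line `birth` (multiplicity one
mod `2` for depleted plus-symbol functions), discharged for both sides of the crux.

References: [Manin1972] §1.5–1.7, Thm. 1.9; [CremonaAlgorithms1997] §2.1–2.2, §2.8; [MazurTateTeitelbaum1986Invent] §I.8.
-/

noncomputable section

-- justification: the `Summit.BirchSwinnertonDyer.BirchSwinnertonDyer.…` path repeats a component (route-file convention)
set_option linter.dupNamespace false

open scoped Classical MatrixGroups

open CongruenceSubgroup Literature.NumberTheory.EllipticCurves Literature.NumberTheory.EllipticCurves.ModularForms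

namespace Summit.BirchSwinnertonDyer.BirchSwinnertonDyer.Theorems.ThetaLayerLambdaCongruenceAtTwo

/-! ## §1. The plus symbol satisfies Manin's relation -/

section PlusSymbol

variable {N : ℕ} [NeZero N] (g : CuspForm (Gamma0 N) 2)

omit [NeZero N] in
/-- The sign-conjugate `γ' = εγε = (a, −b; −c, d)` of `γ ∈ Γ₀(N)` lies in `Γ₀(N)`. [cite: Manin1972, §1.6] -/
theorem exists_gamma0_signConj (γ : Gamma0 N) :
    ∃ γ' : Gamma0 N, ((γ' : SL(2, ℤ)) 0 0 = (γ : SL(2, ℤ)) 0 0 ∧ (γ' : SL(2, ℤ)) 0 1 = -((γ : SL(2, ℤ)) 0 1) ∧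
      (γ' : SL(2, ℤ)) 1 0 = -((γ : SL(2, ℤ)) 1 0) ∧ (γ' : SL(2, ℤ)) 1 1 = (γ : SL(2, ℤ)) 1 1) := by
  have hdet :
      (γ : SL(2, ℤ)) 0 0 * (γ : SL(2, ℤ)) 1 1 - (γ : SL(2, ℤ)) 0 1 * (γ : SL(2, ℤ)) 1 0 = 1 := by
    have := Matrix.det_fin_two (γ : SL(2, ℤ)).1
    rw [(γ : SL(2, ℤ)).2] at this
    linear_combination -this
  let M : SL(2, ℤ) := ⟨!![(γ : SL(2, ℤ)) 0 0, -((γ : SL(2, ℤ)) 0 1);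
      -((γ : SL(2, ℤ)) 1 0), (γ : SL(2, ℤ)) 1 1], by
    rw [Matrix.det_fin_two_of]; linear_combination hdet⟩
  have hM : M ∈ Gamma0 N := by
    rw [Gamma0_mem]
    have hγ := Gamma0_mem.mp γ.2
    simp only [M, Matrix.of_apply, Matrix.cons_val', Matrix.cons_val_zero, Matrix.cons_val_one,
      Int.cast_neg, hγ, neg_zero]
  exact ⟨⟨M, hM⟩, rfl, rfl, rfl, rfl⟩

/-- **Manin's relation for the PLUS symbol**: `plusSymbol g (γ·r) = plusSymbol g (γ·∞) + plusSymbol g r` for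
`γ = (a,b;c,d) ∈ Γ₀(N)` and `r ∈ ℚ` with `cr + d ≠ 0` (the cusp term `plusSymbol g (a/c)` read as `0` when `c = 0`).
From `{∞, γ·s} = {∞, γ·∞} + {∞, s}` (`modularSymbol_gamma0_smul_holds`) at `(γ, r)` and at `(γ', −r)`, `γ' = εγε`,
using `γ'·(−r) = −γ·r`, `γ'·∞ = −γ·∞`. [cite: Manin1972, §1.6 and Thm. 1.9] -/
theorem plusSymbol_gamma0_smul :
    (∀ (γ : CongruenceSubgroup.Gamma0 (N)) (r : ℚ), ((γ : SL(2, ℤ)) 1 0 : ℚ) * r + ((γ : SL(2, ℤ)) 1 1 : ℚ) ≠ 0 → (plusSymbol g) ((((γ : SL(2, ℤ)) 0 0 : ℚ) * r + ((γ : SL(2, ℤ)) 0 1 : ℚ)) / (((γ : SL(2, ℤ)) 1 0 : ℚ) * r + ((γ : SL(2, ℤ)) 1 1 : ℚ))) = (if ((γ : SL(2, ℤ)) 1 0) = 0 then 0 else (plusSymbol g) ((((γ : SL(2, ℤ)) 0 0 : ℚ)) / (((γ : SL(2, ℤ)) 1 0 : ℚ)))) + (plusSymbol g) r) := by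
  intro γ r hr
  obtain ⟨γ', h00, h01, h10, h11⟩ := exists_gamma0_signConj γ
  have h1 := modularSymbol_gamma0_smul_holds g γ r hr
  have hr' : ((γ' : SL(2, ℤ)) 1 0 : ℚ) * (-r) + ((γ' : SL(2, ℤ)) 1 1 : ℚ) ≠ 0 := by
    rw [h10, h11, Int.cast_neg, neg_mul_neg]
    exact hr
  have h2 := modularSymbol_gamma0_smul_holds g γ' (-r) hr'
  have e2 : (((γ' : SL(2, ℤ)) 0 0 : ℚ) * (-r) + ((γ' : SL(2, ℤ)) 0 1 : ℚ)) /
      (((γ' : SL(2, ℤ)) 1 0 : ℚ) * (-r) + ((γ' : SL(2, ℤ)) 1 1 : ℚ)) =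
      -(((((γ : SL(2, ℤ)) 0 0 : ℚ) * r + ((γ : SL(2, ℤ)) 0 1 : ℚ)) /
        (((γ : SL(2, ℤ)) 1 0 : ℚ) * r + ((γ : SL(2, ℤ)) 1 1 : ℚ)))) := by
    rw [h00, h01, h10, h11]
    push_cast
    rw [neg_mul_neg, ← neg_div]
    ring
  have hcusp' : cuspSymbol g γ' =
      (if ((γ : SL(2, ℤ)) 1 0) = 0 then 0
        else modularSymbol g (-((((γ : SL(2, ℤ)) 0 0 : ℚ)) / (((γ : SL(2, ℤ)) 1 0 : ℚ))))) := by
    unfold cuspSymbol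
    rw [h00, h10]
    by_cases hc : (γ : SL(2, ℤ)) 1 0 = 0
    · rw [if_pos (neg_eq_zero.mpr hc), if_pos hc]
    · rw [if_neg (neg_ne_zero.mpr hc), if_neg hc, Int.cast_neg, div_neg]
  rw [e2, hcusp'] at h2
  unfold plusSymbol
  rw [h1, h2]
  unfold cuspSymbol
  by_cases hc : (γ : SL(2, ℤ)) 1 0 = 0
  · rw [if_pos hc, if_pos hc, if_pos hc]
    ring
  · rw [if_neg hc, if_neg hc, if_neg hc]
    ring

variable {g}

/-- **Manin's relation for `ι ∘ [·]⁺_{g,Ω}`** at a plus period `Ω` along any additive map `ι` out of `K_g` (e.g. a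
`2`-adic embedding): the partner's plus-symbol function is a Γ₀(N)-symbol function. [cite: Manin1972, Thm. 1.9] -/
theorem embPlusSymbolK_gamma0_smul {Ω : ℂ} (hΩ : IsPlusPeriod g Ω) {R : Type*} [AddCommGroup R]
    (ι : coeffField g →+ R) :
    (∀ (γ : CongruenceSubgroup.Gamma0 (N)) (r : ℚ), ((γ : SL(2, ℤ)) 1 0 : ℚ) * r + ((γ : SL(2, ℤ)) 1 1 : ℚ) ≠ 0 → (fun x ↦ ι (plusSymbolK g Ω x)) ((((γ : SL(2, ℤ)) 0 0 : ℚ) * r + ((γ : SL(2, ℤ)) 0 1 : ℚ)) / (((γ : SL(2, ℤ)) 1 0 : ℚ) * r + ((γ : SL(2, ℤ)) 1 1 : ℚ))) = (if ((γ : SL(2, ℤ)) 1 0) = 0 then 0 else (fun x ↦ ι (plusSymbolK g Ω x)) ((((γ : SL(2, ℤ)) 0 0 : ℚ)) / (((γ : SL(2, ℤ)) 1 0 : ℚ)))) + (fun x ↦ ι (plusSymbolK g Ω x)) r) := by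
  intro γ r hr
  have h := plusSymbol_gamma0_smul g γ r hr
  have key : plusSymbolK g Ω ((((γ : SL(2, ℤ)) 0 0 : ℚ) * r + ((γ : SL(2, ℤ)) 0 1 : ℚ)) /
        (((γ : SL(2, ℤ)) 1 0 : ℚ) * r + ((γ : SL(2, ℤ)) 1 1 : ℚ))) =
      (if ((γ : SL(2, ℤ)) 1 0) = 0 then 0
        else plusSymbolK g Ω ((((γ : SL(2, ℤ)) 0 0 : ℚ)) / (((γ : SL(2, ℤ)) 1 0 : ℚ)))) + plusSymbolK g Ω r := by
    apply Subtype.ext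
    rw [hΩ.coe_plusSymbolK, h]
    by_cases hc : (γ : SL(2, ℤ)) 1 0 = 0
    · rw [if_pos hc, if_pos hc, zero_add, zero_add, hΩ.coe_plusSymbolK]
    · rw [if_neg hc, if_neg hc, AddMemClass.coe_add, hΩ.coe_plusSymbolK, hΩ.coe_plusSymbolK, add_div]
  simp only [key, map_add]
  by_cases hc : (γ : SL(2, ℤ)) 1 0 = 0
  · rw [if_pos hc, if_pos hc, map_zero]
  · rw [if_neg hc, if_neg hc]

/-- **Manin's relation for the rational plus symbol `[·]⁺_f` of a rational newform** (`coeffField f = ⊥`), in `ℚ`: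
divide the plus-symbol relation by `Ω⁺_f ≠ 0` (`[r]⁺_f · Ω⁺_f = plusSymbol f r`). [cite: Manin1972, Thm. 1.9] -/
theorem ratPlusSymbol_gamma0_smul {f : CuspForm (Gamma0 N) 2} (hf : IsNewform0 f) (hQ : coeffField f = ⊥) :
    (∀ (γ : CongruenceSubgroup.Gamma0 (N)) (r : ℚ), ((γ : SL(2, ℤ)) 1 0 : ℚ) * r + ((γ : SL(2, ℤ)) 1 1 : ℚ) ≠ 0 → (ratPlusSymbol f) ((((γ : SL(2, ℤ)) 0 0 : ℚ) * r + ((γ : SL(2, ℤ)) 0 1 : ℚ)) / (((γ : SL(2, ℤ)) 1 0 : ℚ) * r + ((γ : SL(2, ℤ)) 1 1 : ℚ))) = (if ((γ : SL(2, ℤ)) 1 0) = 0 then 0 else (ratPlusSymbol f) ((((γ : SL(2, ℤ)) 0 0 : ℚ)) / (((γ : SL(2, ℤ)) 1 0 : ℚ)))) + (ratPlusSymbol f) r) := by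
  intro γ r hr
  have hΩ : (plusPeriod f : ℂ) ≠ 0 := by exact_mod_cast (IsNewform0.plusPeriod_pos_holds hf hQ).ne'
  have h := plusSymbol_gamma0_smul f γ r hr
  rw [← ratCast_ratPlusSymbol_mul_plusPeriod f hf hQ, ← ratCast_ratPlusSymbol_mul_plusPeriod f hf hQ,
    ← ratCast_ratPlusSymbol_mul_plusPeriod f hf hQ] at h
  by_cases hc : (γ : SL(2, ℤ)) 1 0 = 0
  · rw [if_pos hc, zero_add] at h
    rw [if_pos hc, zero_add]
    exact_mod_cast mul_right_cancel₀ hΩ h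
  · rw [if_neg hc, ← add_mul] at h
    rw [if_neg hc]
    exact_mod_cast mul_right_cancel₀ hΩ h

/-- Manin's relation for `[·]⁺_f` of a rational newform read in any ring through a ring map `j : ℚ → R` (e.g.
`ℚ → ℚ̄₂`). [cite: Manin1972, Thm. 1.9] -/
theorem map_ratPlusSymbol_gamma0_smul {f : CuspForm (Gamma0 N) 2} (hf : IsNewform0 f) (hQ : coeffField f = ⊥)
    {R : Type*} [NonAssocSemiring R] (j : ℚ →+* R) :
    (∀ (γ : CongruenceSubgroup.Gamma0 (N)) (r : ℚ), ((γ : SL(2, ℤ)) 1 0 : ℚ) * r + ((γ : SL(2, ℤ)) 1 1 : ℚ) ≠ 0 → (fun x ↦ j (ratPlusSymbol f x)) ((((γ : SL(2, ℤ)) 0 0 : ℚ) * r + ((γ : SL(2, ℤ)) 0 1 : ℚ)) / (((γ : SL(2, ℤ)) 1 0 : ℚ) * r + ((γ : SL(2, ℤ)) 1 1 : ℚ))) = (if ((γ : SL(2, ℤ)) 1 0) = 0 then 0 else (fun x ↦ j (ratPlusSymbol f x)) ((((γ : SL(2, ℤ)) 0 0 : ℚ)) / (((γ : SL(2, ℤ))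 1 0 : ℚ)))) + (fun x ↦ j (ratPlusSymbol f x)) r) := by
  intro γ r hr
  simp only [ratPlusSymbol_gamma0_smul hf hQ γ r hr, map_add]
  by_cases hc : (γ : SL(2, ℤ)) 1 0 = 0
  · rw [if_pos hc, if_pos hc, map_zero]
  · rw [if_neg hc, if_neg hc]

end PlusSymbol

/-! ## §2. Structure: level change, scalars, sums, dilation; depleted sums -/

section Structure

variable {R : Type*} [CommRing R]

/-- Level change: a Γ₀(N)-symbol function is a Γ₀(N')-symbol function for `N ∣ N'`. [cite: Manin1972, §1.5] -/
theorem gamma0_smul_of_dvd {N N' : ℕ} (hNN' : N ∣ N') (Φ : ℚ → R)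
    (hΦ : (∀ (γ : CongruenceSubgroup.Gamma0 (N)) (r : ℚ), ((γ : SL(2, ℤ)) 1 0 : ℚ) * r + ((γ : SL(2, ℤ)) 1 1 : ℚ) ≠ 0 → Φ ((((γ : SL(2, ℤ)) 0 0 : ℚ) * r + ((γ : SL(2, ℤ)) 0 1 : ℚ)) / (((γ : SL(2, ℤ)) 1 0 : ℚ) * r + ((γ : SL(2, ℤ)) 1 1 : ℚ))) = (if ((γ : SL(2, ℤ)) 1 0) = 0 then 0 else Φ ((((γ : SL(2, ℤ)) 0 0 : ℚ)) / (((γ : SL(2, ℤ)) 1 0 : ℚ)))) + Φ r)) :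
    (∀ (γ : CongruenceSubgroup.Gamma0 (N')) (r : ℚ), ((γ : SL(2, ℤ)) 1 0 : ℚ) * r + ((γ : SL(2, ℤ)) 1 1 : ℚ) ≠ 0 → Φ ((((γ : SL(2, ℤ)) 0 0 : ℚ) * r + ((γ : SL(2, ℤ)) 0 1 : ℚ)) / (((γ : SL(2, ℤ)) 1 0 : ℚ) * r + ((γ : SL(2, ℤ)) 1 1 : ℚ))) = (if ((γ : SL(2, ℤ)) 1 0) = 0 then 0 else Φ ((((γ : SL(2, ℤ)) 0 0 : ℚ)) / (((γ : SL(2, ℤ)) 1 0 : ℚ)))) + Φ r) := by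
  intro γ r hr
  have hmem : (γ : SL(2, ℤ)) ∈ Gamma0 N := by
    rw [Gamma0_mem]
    have h := Gamma0_mem.mp γ.2
    rw [ZMod.intCast_zmod_eq_zero_iff_dvd] at h ⊢
    exact (Int.natCast_dvd_natCast.mpr hNN').trans h
  exact hΦ ⟨(γ : SL(2, ℤ)), hmem⟩ r hr

/-- Scalar multiples of a Γ₀(N)-symbol function are Γ₀(N)-symbol functions. [cite: Manin1972, §1.5] -/
theorem gamma0_smul_const_mul {N : ℕ} (c : R) (Φ : ℚ → R)
    (hΦ : (∀ (γ : CongruenceSubgroup.Gamma0 (N)) (r : ℚ), ((γ : SL(2, ℤ)) 1 0 : ℚ) * r + ((γ : SL(2, ℤ)) 1 1 : ℚ) ≠ 0 → Φ ((((γ : SL(2, ℤ)) 0 0 : ℚ) * r + ((γ : SL(2, ℤ)) 0 1 : ℚ)) / (((γ : SL(2, ℤ)) 1 0 : ℚ) * r + ((γ : SL(2, ℤ)) 1 1 : ℚ))) = (if ((γ : SL(2, ℤ)) 1 0) = 0 then 0 else Φ ((((γ : SL(2, ℤ)) 0 0 : ℚ)) / (((γ : SL(2, ℤ)) 1 0 :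 ℚ)))) + Φ r)) :
    (∀ (γ : CongruenceSubgroup.Gamma0 (N)) (r : ℚ), ((γ : SL(2, ℤ)) 1 0 : ℚ) * r + ((γ : SL(2, ℤ)) 1 1 : ℚ) ≠ 0 → (fun x ↦ c * Φ x) ((((γ : SL(2, ℤ)) 0 0 : ℚ) * r + ((γ : SL(2, ℤ)) 0 1 : ℚ)) / (((γ : SL(2, ℤ)) 1 0 : ℚ) * r + ((γ : SL(2, ℤ)) 1 1 : ℚ))) = (if ((γ : SL(2, ℤ)) 1 0) = 0 then 0 else (fun x ↦ c * Φ x) ((((γ : SL(2, ℤ)) 0 0 : ℚ)) / (((γ : SL(2, ℤ)) 1 0 : ℚ)))) + (fun x ↦ c * Φ x) r) := by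
  intro γ r hr
  simp only [hΦ γ r hr, mul_add]
  by_cases hc : (γ : SL(2, ℤ)) 1 0 = 0
  · rw [if_pos hc, if_pos hc, mul_zero]
  · rw [if_neg hc, if_neg hc]

/-- Finite sums of Γ₀(N)-symbol functions are Γ₀(N)-symbol functions. [cite: Manin1972, §1.5] -/
theorem gamma0_smul_sum {N : ℕ} {α : Type*} (s : Finset α) (Φ : α → ℚ → R)
    (hΦ : ∀ i ∈ s, (∀ (γ : CongruenceSubgroup.Gamma0 (N)) (r : ℚ), ((γ : SL(2, ℤ)) 1 0 : ℚ) * r + ((γ : SL(2, ℤ)) 1 1 : ℚ) ≠ 0 → (Φ i) ((((γ : SL(2, ℤ)) 0 0 : ℚ) * r + ((γ : SL(2, ℤ)) 0 1 : ℚ)) / (((γ : SL(2, ℤ)) 1 0 : ℚ) * r + ((γ : SL(2, ℤ)) 1 1 : ℚ))) = (if ((γ : SL(2, ℤ)) 1 0) = 0 then 0 else (Φ i) ((((γ : SL(2, ℤ)) 0 0 : ℚ)) / (((γ : SL(2, ℤ)) 1 0 : ℚ)))) + (Φ i) r)) :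
    (∀ (γ : CongruenceSubgroup.Gamma0 (N)) (r : ℚ), ((γ : SL(2, ℤ)) 1 0 : ℚ) * r + ((γ : SL(2, ℤ)) 1 1 : ℚ) ≠ 0 → (fun x ↦ ∑ i ∈ s, Φ i x) ((((γ : SL(2, ℤ)) 0 0 : ℚ) * r + ((γ : SL(2, ℤ)) 0 1 : ℚ)) / (((γ : SL(2, ℤ)) 1 0 : ℚ) * r + ((γ : SL(2, ℤ)) 1 1 : ℚ))) = (if ((γ : SL(2, ℤ)) 1 0) = 0 then 0 else (fun x ↦ ∑ i ∈ s, Φ i x) ((((γ : SL(2, ℤ)) 0 0 : ℚ)) / (((γ : SL(2, ℤ)) 1 0 : ℚ)))) + (fun x ↦ ∑ i ∈ s, Φ i x) r) := by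
  intro γ r hr
  simp only
  rw [Finset.sum_congr rfl fun i hi ↦ hΦ i hi γ r hr, Finset.sum_add_distrib]
  by_cases hc : (γ : SL(2, ℤ)) 1 0 = 0
  · simp only [if_pos hc, Finset.sum_const_zero]
  · simp only [if_neg hc]

/-- **Dilation**: if `Φ` is a Γ₀(N)-symbol function then `r ↦ Φ(r·m)` is a Γ₀(N·m)-symbol function (`m ≥ 1`):
for `γ = (a,b;c,d) ∈ Γ₀(Nm)` put `γ_m = (a, bm; c/m, d) ∈ Γ₀(N)`; then `(γ·r)·m = γ_m·(r·m)` and `(γ·∞)·m = γ_m·∞`.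
This is the operator `[m]` of the depletion `P_ℓ(ℓ⁻¹[ℓ])` (the plus symbol of `f|V_m` up to `m⁻¹`).
[cite: GreenbergVatsal2000, §1 (8)] -/
theorem gamma0_smul_dilate {N : ℕ} (m : ℕ) (hm : 0 < m) (Φ : ℚ → R)
    (hΦ : (∀ (γ : CongruenceSubgroup.Gamma0 (N)) (r : ℚ), ((γ : SL(2, ℤ)) 1 0 : ℚ) * r + ((γ : SL(2, ℤ)) 1 1 : ℚ) ≠ 0 → Φ ((((γ : SL(2, ℤ)) 0 0 : ℚ) * r + ((γ : SL(2, ℤ)) 0 1 : ℚ)) / (((γ : SL(2, ℤ)) 1 0 : ℚ) * r + ((γ : SL(2, ℤ)) 1 1 : ℚ))) = (if ((γ : SL(2, ℤ)) 1 0) = 0 then 0 else Φ ((((γ : SL(2, ℤ)) 0 0 : ℚ)) / (((γ : SL(2, ℤ)) 1 0 : ℚ)))) + Φ r)) :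
    (∀ (γ : CongruenceSubgroup.Gamma0 (N * m)) (r : ℚ), ((γ : SL(2, ℤ)) 1 0 : ℚ) * r + ((γ : SL(2, ℤ)) 1 1 : ℚ) ≠ 0 → (fun x ↦ Φ (x * m)) ((((γ : SL(2, ℤ)) 0 0 : ℚ) * r + ((γ : SL(2, ℤ)) 0 1 : ℚ)) / (((γ : SL(2, ℤ)) 1 0 : ℚ) * r + ((γ : SL(2, ℤ)) 1 1 : ℚ))) = (if ((γ : SL(2, ℤ)) 1 0) = 0 then 0 else (fun x ↦ Φ (x * m)) ((((γ : SL(2, ℤ)) 0 0 : ℚ)) / (((γ : SL(2, ℤ)) 1 0 : ℚ)))) + (fun x ↦ Φ (x * m)) r) := by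
  intro γ r hr
  -- `m ∣ c`
  have hcNm : ((N * m : ℕ) : ℤ) ∣ (γ : SL(2, ℤ)) 1 0 := by
    have h := Gamma0_mem.mp γ.2
    rwa [ZMod.intCast_zmod_eq_zero_iff_dvd] at h
  have hmNm : (m : ℤ) ∣ ((N * m : ℕ) : ℤ) := ⟨(N : ℤ), by push_cast; ring⟩
  obtain ⟨c', hc'⟩ : (m : ℤ) ∣ (γ : SL(2, ℤ)) 1 0 := hmNm.trans hcNm
  have hdet : (γ : SL(2, ℤ)) 0 0 * (γ : SL(2, ℤ)) 1 1 - (γ : SL(2, ℤ)) 0 1 * (γ : SL(2, ℤ)) 1 0 = 1 := by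
    have := Matrix.det_fin_two (γ : SL(2, ℤ)).1
    rw [(γ : SL(2, ℤ)).2] at this
    linear_combination -this
  let Mm : SL(2, ℤ) := ⟨!![(γ : SL(2, ℤ)) 0 0, (γ : SL(2, ℤ)) 0 1 * m; c', (γ : SL(2, ℤ)) 1 1], by
    rw [Matrix.det_fin_two_of]
    have : (γ : SL(2, ℤ)) 0 1 * (m : ℤ) * c' = (γ : SL(2, ℤ)) 0 1 * (γ : SL(2, ℤ)) 1 0 := by rw [hc']; ring
    linear_combination hdet - this⟩
  have hMm : Mm ∈ Gamma0 N := by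
    rw [Gamma0_mem, ZMod.intCast_zmod_eq_zero_iff_dvd]
    have hm0 : (m : ℤ) ≠ 0 := by exact_mod_cast hm.ne'
    have h2 : (m : ℤ) * N ∣ (m : ℤ) * c' := by
      rw [← hc', mul_comm (m : ℤ) N]
      exact_mod_cast hcNm
    simp only [Mm, Matrix.of_apply, Matrix.cons_val', Matrix.cons_val_zero, Matrix.cons_val_one]
    exact (mul_dvd_mul_iff_left hm0).mp h2
  have h00 : ((⟨Mm, hMm⟩ : Gamma0 N) : SL(2, ℤ)) 0 0 = (γ : SL(2, ℤ)) 0 0 := rfl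
  have h01 : ((⟨Mm, hMm⟩ : Gamma0 N) : SL(2, ℤ)) 0 1 = (γ : SL(2, ℤ)) 0 1 * m := rfl
  have h10 : ((⟨Mm, hMm⟩ : Gamma0 N) : SL(2, ℤ)) 1 0 = c' := rfl
  have h11 : ((⟨Mm, hMm⟩ : Gamma0 N) : SL(2, ℤ)) 1 1 = (γ : SL(2, ℤ)) 1 1 := rfl
  have hcQ : ((γ : SL(2, ℤ)) 1 0 : ℚ) = (m : ℚ) * (c' : ℚ) := by exact_mod_cast hc'
  have hcr : (c' : ℚ) * (r * m) = ((γ : SL(2, ℤ)) 1 0 : ℚ) * r := by rw [hcQ]; ring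
  have hr' : (((⟨Mm, hMm⟩ : Gamma0 N) : SL(2, ℤ)) 1 0 : ℚ) * (r * m) +
      (((⟨Mm, hMm⟩ : Gamma0 N) : SL(2, ℤ)) 1 1 : ℚ) ≠ 0 := by
    rw [h10, h11, hcr]
    exact hr
  have h := hΦ ⟨Mm, hMm⟩ (r * m) hr'
  rw [h00, h01, h10, h11] at h
  -- identify the arguments
  have e1 : ((((γ : SL(2, ℤ)) 0 0 : ℚ) * r + ((γ : SL(2, ℤ)) 0 1 : ℚ)) /
        (((γ : SL(2, ℤ)) 1 0 : ℚ) * r + ((γ : SL(2, ℤ)) 1 1 : ℚ))) * m =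
      (((γ : SL(2, ℤ)) 0 0 : ℚ) * (r * m) + (((γ : SL(2, ℤ)) 0 1 * m : ℤ) : ℚ)) /
        ((c' : ℚ) * (r * m) + ((γ : SL(2, ℤ)) 1 1 : ℚ)) := by
    rw [hcr]
    push_cast
    rw [div_mul_eq_mul_div]
    ring_nf
  have hc0 : (c' = 0) ↔ ((γ : SL(2, ℤ)) 1 0 = 0) := by
    rw [hc']
    constructor
    · intro h0; rw [h0, mul_zero]
    · intro h0
      rcases mul_eq_zero.mp h0 with h0 | h0
      · exact absurd h0 (by exact_mod_cast hm.ne')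
      · exact h0
  simp only
  rw [e1, h]
  by_cases hc : (γ : SL(2, ℤ)) 1 0 = 0
  · rw [if_pos (hc0.mpr hc), if_pos hc]
  · rw [if_neg (fun h0 ↦ hc (hc0.mp h0)), if_neg hc]
    congr 2
    rw [hcQ]
    have hc'0 : (c' : ℚ) ≠ 0 := by exact_mod_cast fun h0 ↦ hc (hc0.mp h0)
    have hm0 : (m : ℚ) ≠ 0 := by exact_mod_cast hm.ne'
    field_simp

/-- **Depleted sums are symbol functions**: if `Φ` is a Γ₀(N)-symbol function and every `m_k ∣ m` (`m ≥ 1`), then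
`r ↦ ∑_{k∈s} c_k · Φ(r · m_k)` is a Γ₀(N·m)-symbol function — the shape of the explicit depleted plus symbols of
`…DepletionExact` (`m_k = ∏_v ℓ_v^{k_v} ∣ ∏_v ℓ_v²`). [cite: GreenbergVatsal2000, §1 (8)] -/
theorem gamma0_smul_sum_dilate {N : ℕ} {α : Type*} (s : Finset α) (c : α → R) (mk : α → ℕ) (m : ℕ)
    (hm : 0 < m) (hmk : ∀ k ∈ s, mk k ∣ m) (Φ : ℚ → R)
    (hΦ : (∀ (γ : CongruenceSubgroup.Gamma0 (N)) (r : ℚ), ((γ : SL(2, ℤ)) 1 0 : ℚ) * r + ((γ : SL(2, ℤ)) 1 1 : ℚ) ≠ 0 → Φ ((((γ : SL(2, ℤ)) 0 0 : ℚ) * r + ((γ : SL(2, ℤ)) 0 1 : ℚ)) / (((γ : SL(2, ℤ)) 1 0 : ℚ) * r + ((γ : SL(2, ℤ)) 1 1 : ℚ))) = (if ((γ : SL(2, ℤ)) 1 0) = 0 then 0 else Φ ((((γ : SL(2, ℤ)) 0 0 : ℚ)) / (((γ : SL(2, ℤ)) 1 0 : ℚ)))) + Φ r)) :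
    (∀ (γ : CongruenceSubgroup.Gamma0 (N * m)) (r : ℚ), ((γ : SL(2, ℤ)) 1 0 : ℚ) * r + ((γ : SL(2, ℤ)) 1 1 : ℚ) ≠ 0 → (fun x ↦ ∑ k ∈ s, c k * Φ (x * (mk k : ℕ))) ((((γ : SL(2, ℤ)) 0 0 : ℚ) * r + ((γ : SL(2, ℤ)) 0 1 : ℚ)) / (((γ : SL(2, ℤ)) 1 0 : ℚ) * r + ((γ : SL(2, ℤ)) 1 1 : ℚ))) = (if ((γ : SL(2, ℤ)) 1 0) = 0 then 0 else (fun x ↦ ∑ k ∈ s, c k * Φ (x * (mk k : ℕ))) ((((γ : SL(2, ℤ)) 0 0 : ℚ)) / (((γ : SL(2, ℤ)) 1 0 : ℚ)))) + (fun x ↦ ∑ k ∈ s, c k * Φ (x * (mk k : ℕ))) r) := by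
  refine gamma0_smul_sum s (fun k x ↦ c k * Φ (x * (mk k : ℕ))) fun k hk ↦ ?_
  have hk0 : 0 < mk k := Nat.pos_of_dvd_of_pos (hmk k hk) hm
  have h1 := gamma0_smul_dilate (mk k) hk0 Φ hΦ
  have h2 := gamma0_smul_of_dvd (N := N * mk k) (N' := N * m) (Nat.mul_dvd_mul_left N (hmk k hk))
    (fun x ↦ Φ (x * (mk k : ℕ))) h1
  exact gamma0_smul_const_mul (c k) (fun x ↦ Φ (x * (mk k : ℕ))) h2

end Structure

/-! ## §3. Both depleted plus symbols of the crux are Γ₀-symbol functions of the depleted level -/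

section Depleted

/-- `∏_v ℓ_v^{k_v} ∣ ∏_v ℓ_v²` for `k ∈ {0,1,2}^{S₀}`, and `∏_v ℓ_v² ≥ 1`. [folklore] -/
theorem prod_pow_dvd_prod_sq (S₀ : Finset (IsDedekindDomain.HeightOneSpectrum (NumberField.RingOfIntegers ℚ)))
    (k : S₀ → ℕ) (hk : k ∈ Fintype.piFinset (fun _ : S₀ ↦ Finset.range 3)) :
    (∏ v : S₀, Rat.HeightOneSpectrum.natGenerator (v : IsDedekindDomain.HeightOneSpectrum (NumberField.RingOfIntegers ℚ)) ^ (k v)) ∣ ∏ v : S₀, Rat.HeightOneSpectrum.natGenerator (v : IsDedekindDomain.HeightOneSpectrum (NumberField.RingOfIntegers ℚ)) ^ 2 := by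
  refine Finset.prod_dvd_prod_of_dvd _ _ fun v _ ↦ pow_dvd_pow _ ?_
  have := Finset.mem_range.mp (Fintype.mem_piFinset.mp hk v)
  omega

/-- `∏_v ℓ_v² ≥ 1`. [folklore] -/
theorem prod_natGenerator_sq_pos (S₀ : Finset (IsDedekindDomain.HeightOneSpectrum (NumberField.RingOfIntegers ℚ))) :
    0 < ∏ v : S₀, Rat.HeightOneSpectrum.natGenerator (v : IsDedekindDomain.HeightOneSpectrum (NumberField.RingOfIntegers ℚ)) ^ 2 :=
  Finset.prod_pos fun _ _ ↦ pow_pos (Rat.HeightOneSpectrum.prime_natGenerator _).pos 2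

/-- **The partner's depleted plus symbol `φ^{S₀}_{g,Ω}` (explicit form of `…DepletionExact`) is a
Γ₀(M·∏_v ℓ_v²)-symbol function** (plus period `Ω`, any `S₀`). [cite: GreenbergVatsal2000, §1 (8)] -/
theorem depletedPartnerSymbol_gamma0_smul {M : ℕ} [NeZero M] (g : CuspForm (Gamma0 M) 2)
    (ι : coeffField g →+* PadicAlgCl 2) {Ω : ℂ} (hΩ : IsPlusPeriod g Ω)
    (S₀ : Finset (IsDedekindDomain.HeightOneSpectrum (NumberField.RingOfIntegers ℚ))) :
    (∀ (γ : CongruenceSubgroup.Gamma0 (M * ∏ v : S₀, Rat.HeightOneSpectrum.natGenerator (v : IsDedekindDomain.HeightOneSpectrum (NumberField.RingOfIntegers ℚ)) ^ 2)) (r : ℚ), ((γ : SL(2, ℤ)) 1 0 : ℚ) * r + ((γ : SL(2, ℤ)) 1 1 : ℚ) ≠ 0 → (fun x ↦ ∑ k ∈ Fintype.piFinset (fun _ : S₀ ↦ Finset.range 3), (∏ v : S₀, (1 - Polynomial.C (embCoeff g ι (Rat.HeightOneSpectrum.natGenerator (v : IsDedekindDomain.HeightOneSpectrum (NumberField.RingOfIntegers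 ℚ)))) * Polynomial.X + (if Rat.HeightOneSpectrum.natGenerator (v : IsDedekindDomain.HeightOneSpectrum (NumberField.RingOfIntegers ℚ)) ∣ M then 0 else Polynomial.C (Rat.HeightOneSpectrum.natGenerator (v : IsDedekindDomain.HeightOneSpectrum (NumberField.RingOfIntegers ℚ)) : PadicAlgCl 2)) * Polynomial.X ^ 2 : Polynomial (PadicAlgCl 2)).coeff (k v) * ((Rat.HeightOneSpectrum.natGenerator (v : IsDedekindDomain.HeightOneSpectrum (NumberField.RingOfIntegers ℚ)) : PadicAlgCl 2)⁻¹) ^ (k v)) * ι (plusSymbolK g Ω (x * ((∏ v : S₀, Rat.HeightOneSpectrum.natGenerator (v : IsDedekindDomain.HeightOneSpectrum (NumberField.RingOfIntegers ℚ)) ^ (k v) : ℕ) : ℚ)))) ((((γ : SL(2, ℤ)) 0 0 : ℚ) * r + ((γ : SL(2, ℤ)) 0 1 : ℚ)) / (((γ : SL(2, ℤ)) 1 0 : ℚ) * r + ((γ : SL(2, ℤ)) 1 1 : ℚ))) = (if ((γ : SL(2, ℤ)) 1 0) = 0 then 0 else (fun x ↦ ∑ k ∈ Fintype.piFinset (fun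 _ : S₀ ↦ Finset.range 3), (∏ v : S₀, (1 - Polynomial.C (embCoeff g ι (Rat.HeightOneSpectrum.natGenerator (v : IsDedekindDomain.HeightOneSpectrum (NumberField.RingOfIntegers ℚ)))) * Polynomial.X + (if Rat.HeightOneSpectrum.natGenerator (v : IsDedekindDomain.HeightOneSpectrum (NumberField.RingOfIntegers ℚ)) ∣ M then 0 else Polynomial.C (Rat.HeightOneSpectrum.natGenerator (v : IsDedekindDomain.HeightOneSpectrum (NumberField.RingOfIntegers ℚ)) : PadicAlgCl 2)) * Polynomial.X ^ 2 : Polynomial (PadicAlgCl 2)).coeff (k v) * ((Rat.HeightOneSpectrum.natGenerator (v : IsDedekindDomain.HeightOneSpectrum (NumberField.RingOfIntegers ℚ)) : PadicAlgCl 2)⁻¹) ^ (k v)) * ι (plusSymbolK g Ω (x * ((∏ v : S₀, Rat.HeightOneSpectrum.natGenerator (v : IsDedekindDomain.HeightOneSpectrum (NumberField.RingOfIntegers ℚ)) ^ (k v) : ℕ) : ℚ)))) ((((γ : SL(2, ℤ)) 0 0 : ℚ)) / (((γ : SL(2, ℤ)) 1 0 : ℚ)))) + (fun x ↦ ∑ k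 ∈ Fintype.piFinset (fun _ : S₀ ↦ Finset.range 3), (∏ v : S₀, (1 - Polynomial.C (embCoeff g ι (Rat.HeightOneSpectrum.natGenerator (v : IsDedekindDomain.HeightOneSpectrum (NumberField.RingOfIntegers ℚ)))) * Polynomial.X + (if Rat.HeightOneSpectrum.natGenerator (v : IsDedekindDomain.HeightOneSpectrum (NumberField.RingOfIntegers ℚ)) ∣ M then 0 else Polynomial.C (Rat.HeightOneSpectrum.natGenerator (v : IsDedekindDomain.HeightOneSpectrum (NumberField.RingOfIntegers ℚ)) : PadicAlgCl 2)) * Polynomial.X ^ 2 : Polynomial (PadicAlgCl 2)).coeff (k v) * ((Rat.HeightOneSpectrum.natGenerator (v : IsDedekindDomain.HeightOneSpectrum (NumberField.RingOfIntegers ℚ)) : PadicAlgCl 2)⁻¹) ^ (k v)) * ι (plusSymbolK g Ω (x * ((∏ v : S₀, Rat.HeightOneSpectrum.natGenerator (v : IsDedekindDomain.HeightOneSpectrum (NumberField.RingOfIntegers ℚ)) ^ (k v) : ℕ) : ℚ)))) r) :=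
  gamma0_smul_sum_dilate _ _ (fun k ↦ ∏ v : S₀, Rat.HeightOneSpectrum.natGenerator (v : IsDedekindDomain.HeightOneSpectrum (NumberField.RingOfIntegers ℚ)) ^ (k v)) _ (prod_natGenerator_sq_pos S₀)
    (fun k hk ↦ prod_pow_dvd_prod_sq S₀ k hk) (fun x ↦ ι (plusSymbolK g Ω x))
    (embPlusSymbolK_gamma0_smul hΩ ι.toAddMonoidHom)

/-- **The curve's depleted plus symbol `φ^{S₀}_W` (explicit form of `…DepletionExact`) is a Γ₀(N_W·∏_v ℓ_v²)-symbol
function**, for the newform `f` of `W` (rational: `IsNewformOf.coeffField_eq_bot`). [cite: GreenbergVatsal2000, §1 (8)] -/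
theorem depletedCurveSymbol_gamma0_smul (W : WeierstrassCurve ℚ) [NeZero (W.conductorNorm ℤ)]
    {f : CuspForm (Gamma0 (W.conductorNorm ℤ)) 2} (hf : IsNewformOf W f)
    (S₀ : Finset (IsDedekindDomain.HeightOneSpectrum (NumberField.RingOfIntegers ℚ))) :
    (∀ (γ : CongruenceSubgroup.Gamma0 (W.conductorNorm ℤ * ∏ v : S₀, Rat.HeightOneSpectrum.natGenerator (v : IsDedekindDomain.HeightOneSpectrum (NumberField.RingOfIntegers ℚ)) ^ 2)) (r : ℚ), ((γ : SL(2, ℤ)) 1 0 : ℚ) * r + ((γ : SL(2, ℤ)) 1 1 : ℚ) ≠ 0 → (fun x ↦ ∑ k ∈ Fintype.piFinset (fun _ : S₀ ↦ Finset.range 3), (∏ v : S₀, ((W.localPolynomialAt (v : IsDedekindDomain.HeightOneSpectrum (NumberField.RingOfIntegers ℚ))).map (Int.castRingHom (PadicAlgCl 2))).coeff (k v) * ((Rat.HeightOneSpectrum.natGenerator (v : IsDedekindDomain.HeightOneSpectrum (NumberField.RingOfIntegers ℚ)) : PadicAlgCl 2)⁻¹) ^ (k v)) * algebraMap ℚ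 (PadicAlgCl 2) (ratPlusSymbol f (x * ((∏ v : S₀, Rat.HeightOneSpectrum.natGenerator (v : IsDedekindDomain.HeightOneSpectrum (NumberField.RingOfIntegers ℚ)) ^ (k v) : ℕ) : ℚ)))) ((((γ : SL(2, ℤ)) 0 0 : ℚ) * r + ((γ : SL(2, ℤ)) 0 1 : ℚ)) / (((γ : SL(2, ℤ)) 1 0 : ℚ) * r + ((γ : SL(2, ℤ)) 1 1 : ℚ))) = (if ((γ : SL(2, ℤ)) 1 0) = 0 then 0 else (fun x ↦ ∑ k ∈ Fintype.piFinset (fun _ : S₀ ↦ Finset.range 3), (∏ v : S₀, ((W.localPolynomialAt (v : IsDedekindDomain.HeightOneSpectrum (NumberField.RingOfIntegers ℚ))).map (Int.castRingHom (PadicAlgCl 2))).coeff (k v) * ((Rat.HeightOneSpectrum.natGenerator (v : IsDedekindDomain.HeightOneSpectrum (NumberField.RingOfIntegers ℚ)) : PadicAlgCl 2)⁻¹) ^ (k v)) * algebraMap ℚ (PadicAlgCl 2) (ratPlusSymbol f (x * ((∏ v : S₀, Rat.HeightOneSpectrum.natGenerator (v : IsDedekindDomain.HeightOneSpectrum (NumberField.RingOfIntegers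 ℚ)) ^ (k v) : ℕ) : ℚ)))) ((((γ : SL(2, ℤ)) 0 0 : ℚ)) / (((γ : SL(2, ℤ)) 1 0 : ℚ)))) + (fun x ↦ ∑ k ∈ Fintype.piFinset (fun _ : S₀ ↦ Finset.range 3), (∏ v : S₀, ((W.localPolynomialAt (v : IsDedekindDomain.HeightOneSpectrum (NumberField.RingOfIntegers ℚ))).map (Int.castRingHom (PadicAlgCl 2))).coeff (k v) * ((Rat.HeightOneSpectrum.natGenerator (v : IsDedekindDomain.HeightOneSpectrum (NumberField.RingOfIntegers ℚ)) : PadicAlgCl 2)⁻¹) ^ (k v)) * algebraMap ℚ (PadicAlgCl 2) (ratPlusSymbol f (x * ((∏ v : S₀, Rat.HeightOneSpectrum.natGenerator (v : IsDedekindDomain.HeightOneSpectrum (NumberField.RingOfIntegers ℚ)) ^ (k v) : ℕ) : ℚ)))) r) :=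
  gamma0_smul_sum_dilate _ _ (fun k ↦ ∏ v : S₀, Rat.HeightOneSpectrum.natGenerator (v : IsDedekindDomain.HeightOneSpectrum (NumberField.RingOfIntegers ℚ)) ^ (k v)) _ (prod_natGenerator_sq_pos S₀)
    (fun k hk ↦ prod_pow_dvd_prod_sq S₀ k hk) (fun x ↦ algebraMap ℚ (PadicAlgCl 2) (ratPlusSymbol f x))
    (map_ratPlusSymbol_gamma0_smul hf.1 hf.coeffField_eq_bot (algebraMap ℚ (PadicAlgCl 2)))

end Depleted

end Summit.BirchSwinnertonDyer.BirchSwinnertonDyer.Theorems.ThetaLayerLambdaCongruenceAtTwo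

end
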